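import Summits.Langlands.Langlands.Theorems.QuadraticWindowHostInducedRepAsaiGlobalFactorisation
import Literature.NumberTheory.Automorphic.AsaiSignCont

/-!
# The Asai pole transfer in continuation form — wave 4 (Cont re-basing) of stub `stub_asaiPoleInduced`,
line `one-transparent-pane`
(crux `Summit.Langlands.Langlands.Theses.QuadraticWindow.HostInducedRep`, item stmt-Langlands-10902)

LOG (Asai worker, wave 4, 2026-08-16).  REGISTERED: `asaiPoleTransfer_cont :
Mok2014_partialAsaiL_continuation_pole_dichotomy → GrbacShahidi2015_partialAsaiL_at_one → TRANSFER_CONT`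
(TRANSFER_CONT verbatim from the lead's CONT_INTERFACES: direction `P → Q`,
`P.1.HasAsaiPoleCont s ε → Q.1.HasAsaiPoleCont cK ε`), ENTIRELY in the continuation-form currency of
`AsaiSignCont.lean`: no raw-product holomorphy (`H₃`) and no typed dichotomy (`H₁`); the only inputs are
the two PUBLISHED named facts `Mok2014_partialAsaiL_continuation_pole_dichotomy` (Mok 2014 §2.5,
Thm. 2.5.4 (a)) and `GrbacShahidi2015_partialAsaiL_at_one` (Grbac–Shahidi 2015 Thm. 4.3 at `s = 1`).
Extra (not registered): `asaiPoleTransfer_cont_iff`, the equivalence `Q.HasAsaiPoleCont cK ε ↔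
P.HasAsaiPoleCont s ε` from the same two facts.  Built on the landed chain (`exists_matched_data`,
`partialAsaiL_induced_eq_mul`, `eventually_norm_prod_eq_one_of_isConjSelfDualAE`, `klein_relations₀`,
`exists_ringHom_of_restricts` of `…AsaiGlobalFactorisation` / `…AsaiLocalIdentityQ` / `…AsaiLocalIdentity`).

## Proof (`exists_clash_datum_cont`, then the sign bookkeeping)

Tower as in `…AsaiPoleInduced`: `Gal(L/F₀) = {1, t, s, st}`, `K = L^t`, `F' = L^s`, `F = L^{st}`
(realised as `IntermediateField.fixedField`, with involution `θF`); matched Asai data `(S₁, A)` of `Q`,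
`(S₁', A')`, `(S₁'', A')` of `P` w.r.t. `F'`, `F` (`exists_matched_data`).  CLASH: for no sign `η` can
`L^{S₁'}(z, P, As^η_{L/F'})` have a CONTINUED simple pole at `1` (`G` holomorphic on `{1/2 < Re z}`,
`G = (z-1) L^{S₁'}` far right, `G(1) ≠ 0`, plus multipliability far right) while `L^{S₁}(z, Q, As^η)` has
a continuation `H` holomorphic on `{1/2 < Re z}`.  Indeed Grbac–Shahidi for `P` (unitary a.e., being
`s`-conjugate self-dual) w.r.t. `(L/F, θF)` at `η` gives `k ≤ 1`, `δ > 0`, `G_F` holomorphic on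
`{1 < Re z} ∪ B(1, δ)` with `G_F = (z-1)^k L^{S₁''}` far right and `G_F(1) ≠ 0`, and multipliability far
right; so far right the factorisation `L^{S₁}(Q) = L^{S₁'}(P, F') · L^{S₁''}(P, F)`
(`partialAsaiL_induced_eq_mul`) reads `(z-1)^{k+1} H(z) = G(z) G_F(z)`; both sides are holomorphic on the
connected open `U = {1 < Re z} ∪ B(1, δ')`, `δ' = min δ (1/2)`, hence agree on `U` (identity theorem),
and at `z = 1 ∈ U`: `0 = G(1) G_F(1) ≠ 0`.  TRANSFER: `Q` is `cK`-conjugate self-dual, so Mok gives `η_Q`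
with `Q.HasAsaiPoleCont cK η_Q` and `Q.HasAsaiHolAtOneCont cK (-η_Q)`; if `ε = η_Q` we are done, else
`ε = -η_Q` and the holomorphic continuation of `L^{S₁}(Q, As^ε)` clashes with the continued pole of `P`
at `ε` on `(S₁', A')`.  Converse (for the `iff`): symmetric, with Mok for `P` and uniqueness of the
continued pole sign of `Q` (`hasAsaiPoleCont_unique`).
-/

set_option linter.dupNamespace false -- project-wide option (lakefile weak.linter.dupNamespace); `Summit.Langlands.Langlands` is the mandated namespace

open scoped BigOperators Polynomial Classical NumberField Topology
open Filter Polynomial IsDedekindDomain NumberField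
open Literature.NumberTheory.Automorphic Literature.NumberTheory.GaloisRepresentations

namespace Summit.Langlands.Langlands.Theorems.HostInducedRep.OneTransparentPane

section Tower

variable {F₀ K F' L : Type} [Field F₀] [NumberField F₀] [Field K] [NumberField K]
  [Field F'] [NumberField F'] [Field L] [NumberField L] [Algebra F₀ K] [Algebra K L] [Algebra F' L]
  {cK : K ≃ₐ[F₀] K} {s : L ≃ₐ[F'] L}

/-- `{1 < Re z} ∪ B(1, δ')` is preconnected (two convex sets through `1 + δ'/2`) and contained in
`{1/2 < Re z}` when `δ' ≤ 1/2`. [folklore] -/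
theorem isPreconnected_one_lt_re_union_ball {δ' : ℝ} (hδ' : 0 < δ') (hδ'h : δ' ≤ 1 / 2) :
    IsPreconnected ({z : ℂ | 1 < z.re} ∪ Metric.ball (1 : ℂ) δ') ∧
      {z : ℂ | 1 < z.re} ∪ Metric.ball (1 : ℂ) δ' ⊆ {z : ℂ | 1 / 2 < z.re} := by
  constructor
  · refine IsPreconnected.union (((1 + δ' / 2 : ℝ) : ℂ)) ?_ ?_
      (convex_halfSpace_re_gt 1).isPreconnected (convex_ball (1 : ℂ) δ').isPreconnected
    · simp only [Set.mem_setOf_eq, Complex.ofReal_re]; linarith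
    · rw [Metric.mem_ball, dist_eq_norm, show ((1 + δ' / 2 : ℝ) : ℂ) - 1 = ((δ' / 2 : ℝ) : ℂ) by
        push_cast; ring, Complex.norm_real, Real.norm_eq_abs, abs_of_pos (by linarith)]
      linarith
  · exact (Set.union_subset_union_right _ (Metric.ball_subset_ball hδ'h)).trans
      one_lt_re_union_ball_one_half_subset

/-- **The clash, continuation form.**  In the tower of the stub, granted Grbac–Shahidi 2015 Thm. 4.3
at `s = 1` (named fact), there are Asai data `(S₁, A)` of `Q` w.r.t. `(K/F₀, cK)` and `(S₁', A')` of `P`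
w.r.t. `(L/F', s)` (matched: `S₁'` is the preimage of `S₁`, `A` is induced from `A'`) such that for no
sign `η` the continued `L^{S₁'}(z, P, As^η_{L/F'})` has a simple pole at `1` (clause (ii) of
`HasAsaiPoleCont` on this datum) while `L^{S₁}(z, Q, As^η)` has a continuation holomorphic on
`{1/2 < Re z}`: far right `(z-1)^{k+1} H = G · G_F` by the factorisation
`L^{S₁}(Q, As^η) = L^{S₁'}(P, As^η_{L/F'}) · L^{S₁''}(P, As^η_{L/F})` and Grbac–Shahidi for the third
subfield `F = L^{st}`, identity theorem on `{1 < Re z} ∪ B(1, δ')`, and `0 = G(1) G_F(1) ≠ 0` at `z = 1`.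
[cite: GrbacShahidi2015, Thm. 4.3] [cite: ArthurClozelAMS120, Ch. 3 Def. 6.1] -/
theorem exists_clash_datum_cont (hGS : GrbacShahidi2015_partialAsaiL_at_one)
    (h2 : Module.finrank F₀ K = 2) (h2K : Module.finrank K L = 2) (h2F' : Module.finrank F' L = 2)
    (hcK : cK ≠ 1) (hs : s ≠ 1) (hsK : ∀ x : K, s (algebraMap K L x) = algebraMap K L (cK x))
    {n : ℕ} {hL : isCompact_glFiniteIntegralLevel n L} {hK : isCompact_glFiniteIntegralLevel (2 * n) K}
    (P : CuspidalAutomorphicRepData n L hL) (Q : CuspidalAutomorphicRepData (2 * n) K hK) (hn : 0 < n)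
    (hAI : IsAutomorphicInductionAlong P.1 Q.1) (hP : P.1.IsConjSelfDualAE s) :
    ∃ (S₁ : Set (HeightOneSpectrum (𝓞 F₀))) (A : SatakeFamily K) (S₁' : Set (HeightOneSpectrum (𝓞 F')))
      (A' : SatakeFamily L), Q.1.IsAsaiDatum cK S₁ A ∧ P.1.IsAsaiDatum s S₁' A' ∧
      ∀ η : ℤˣ,
        (∃ σ₀ : ℝ, 1 ≤ σ₀ ∧
          (∀ z : ℂ, σ₀ < z.re →
            Multipliable fun v : {v : HeightOneSpectrum (𝓞 F') // v ∉ S₁'} =>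
              ((asaiLocalPolynomial s A' η (placeAbove L v.1)).eval ((v.1.residueCard : ℂ) ^ (-z)))⁻¹) ∧
          ∃ G : ℂ → ℂ, DifferentiableOn ℂ G {z : ℂ | 1 / 2 < z.re} ∧
            (∀ z : ℂ, σ₀ < z.re → G z = (z - 1) * partialAsaiL S₁' s A' η z) ∧ G 1 ≠ 0) →
        (∃ (σ₁ : ℝ) (H : ℂ → ℂ), DifferentiableOn ℂ H {z : ℂ | 1 / 2 < z.re} ∧
          ∀ z : ℂ, σ₁ < z.re → H z = partialAsaiL S₁ cK A η z) → False := by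
  /- Step 0: `L` and `F'` as `F₀`-algebras, the involution `t`, and the field `F = L^{s₀ t₀}` -/
  letI algF₀L : Algebra F₀ L := ((algebraMap K L).comp (algebraMap F₀ K)).toAlgebra
  haveI : IsScalarTower F₀ K L := IsScalarTower.of_algebraMap_eq fun _ => rfl
  obtain ⟨φ, hφ⟩ := exists_ringHom_of_restricts h2F' hs hsK
  letI algF₀F' : Algebra F₀ F' := φ.toAlgebra
  haveI : IsScalarTower F₀ F' L := IsScalarTower.of_algebraMap_eq fun x => (hφ x).symm
  have h4 : Module.finrank F₀ L = 4 := by rw [← Module.finrank_mul_finrank F₀ K L, h2, h2K]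
  haveI : FiniteDimensional F₀ L := Module.finite_of_finrank_eq_succ h4
  haveI : Algebra.IsQuadraticExtension K L := { finrank_eq_two' := h2K }
  obtain ⟨t, ht⟩ := Literature.NumberTheory.QuadraticForms.QuadraticExtension.exists_algEquiv_ne_one
    (K := K) (E := L)
  have hsK' : ∀ x : K, s.restrictScalars F₀ (algebraMap K L x) = algebraMap K L (cK x) := hsK
  obtain ⟨-, -, -, hst1, htt, hcomm⟩ := klein_relations₀ h4 h2K hcK ht hsK'
  have hss : s.restrictScalars F₀ * s.restrictScalars F₀ = 1 := by
    rw [← AlgEquiv.restrictScalars_mul', AlgEquiv.mul_self_eq_one_of_finrank_eq_two h2F' s]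
    exact AlgEquiv.ext fun _ => rfl
  set g₀ : L ≃ₐ[F₀] L := s.restrictScalars F₀ * t.restrictScalars F₀ with hg₀
  have hg₀1 : g₀ ≠ 1 := hst1
  have hg₀2 : g₀ ^ 2 = 1 := by
    rw [sq, hg₀]
    calc s.restrictScalars F₀ * t.restrictScalars F₀ * (s.restrictScalars F₀ * t.restrictScalars F₀)
        = s.restrictScalars F₀ * (t.restrictScalars F₀ * s.restrictScalars F₀) * t.restrictScalars F₀ := by
          simp only [mul_assoc]
      _ = s.restrictScalars F₀ * (s.restrictScalars F₀ * t.restrictScalars F₀) * t.restrictScalars F₀ := by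
          rw [hcomm]
      _ = s.restrictScalars F₀ * s.restrictScalars F₀ * (t.restrictScalars F₀ * t.restrictScalars F₀) := by
          simp only [mul_assoc]
      _ = 1 := by rw [hss, htt, one_mul]
  let F : IntermediateField F₀ L := IntermediateField.fixedField (Subgroup.zpowers g₀)
  have hθfix : ∀ x : F, g₀ (x : L) = x := fun x =>
    (IntermediateField.mem_fixedField_iff (Subgroup.zpowers g₀) (x : L)).mp x.2 g₀ (Subgroup.mem_zpowers g₀)
  let θF : L ≃ₐ[F] L := { (g₀ : L ≃+* L) with commutes' := hθfix }
  have hθFapply : ∀ x : L, θF x = g₀ x := fun _ => rfl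
  have h2Fdeg : Module.finrank F L = 2 := by
    rw [IntermediateField.finrank_fixedField_eq_card, Nat.card_zpowers, orderOf_eq_prime hg₀2 hg₀1]
  have hθF1 : θF ≠ 1 := fun h => hg₀1 (AlgEquiv.ext fun x => by
    rw [← hθFapply, h]; rfl)
  have hθF₀ : θF.restrictScalars F₀ = s.restrictScalars F₀ * t.restrictScalars F₀ :=
    AlgEquiv.ext fun _ => rfl
  /- matched Asai data; unitarity a.e. of `P` -/
  obtain ⟨S₁, A, A', hQd, hPd', hPd'', gL, gK, gF', gF, hrel⟩ :=
    exists_matched_data (F' := F') (F := F) h2 h2F' h2Fdeg hcK hs hθF1 P.1 Q.1 hAI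
  have huP := eventually_norm_prod_eq_one_of_isConjSelfDualAE hn P hP
  refine ⟨S₁, A, _, A', hQd, hPd', fun η ⟨σ₀, hσ₀, hmulF', G, hG, hGeq, hG1⟩ ⟨σ₁, H, hH, hHeq⟩ => ?_⟩
  /- Grbac–Shahidi for `P` w.r.t. `(L/F, θF)` at `η` -/
  obtain ⟨σF, -, hmulF, k, δ, GF, -, hδ, hGFhol, hGFeq, hGF1⟩ :=
    hGS F L θF h2Fdeg hθF1 n hL P hn huP _ A' η hPd''
  -- the factorisation far right: `(z-1)^{k+1} H = G · G_F`
  set σm : ℝ := max (max σ₀ σF) σ₁ with hσm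
  have hfar : ∀ z : ℂ, σm < z.re → (z - 1) ^ (k + 1) * H z = G z * GF z := by
    intro z hz
    have hz₀ : σ₀ < z.re := lt_of_le_of_lt ((le_max_left _ _).trans (le_max_left _ _)) hz
    have hzF : σF < z.re := lt_of_le_of_lt ((le_max_right _ _).trans (le_max_left _ _)) hz
    have hz₁ : σ₁ < z.re := lt_of_le_of_lt (le_max_right _ _) hz
    rw [hHeq z hz₁, hGeq z hz₀, hGFeq z hzF, partialAsaiL_induced_eq_mul h4 h2 h2K h2F' h2Fdeg hcK ht
      hs hθF1 hsK' hθF₀ gL gK gF' gF hrel η (hmulF' z hz₀) (hmulF z hzF)]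
    ring
  -- both sides are holomorphic on the connected open `U = {1 < Re z} ∪ B(1, δ')`
  set δ' : ℝ := min δ (1 / 2) with hδ'
  have hδ'pos : 0 < δ' := lt_min hδ one_half_pos
  obtain ⟨hUconn, hUsub⟩ := isPreconnected_one_lt_re_union_ball hδ'pos (min_le_right _ _)
  have hUopen : IsOpen ({z : ℂ | 1 < z.re} ∪ Metric.ball (1 : ℂ) δ') :=
    (isOpen_lt continuous_const Complex.continuous_re).union Metric.isOpen_ball
  have hUδ : {z : ℂ | 1 < z.re} ∪ Metric.ball (1 : ℂ) δ' ⊆ {z : ℂ | 1 < z.re} ∪ Metric.ball (1 : ℂ) δ :=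
    Set.union_subset_union_right _ (Metric.ball_subset_ball (min_le_left _ _))
  have h₁ : AnalyticOnNhd ℂ (fun z => (z - 1) ^ (k + 1) * H z) ({z : ℂ | 1 < z.re} ∪ Metric.ball 1 δ') :=
    ((((differentiableOn_id.sub_const 1).pow (k + 1)).mul hH).mono hUsub).analyticOnNhd hUopen
  have h₂ : AnalyticOnNhd ℂ (fun z => G z * GF z) ({z : ℂ | 1 < z.re} ∪ Metric.ball 1 δ') :=
    ((hG.mono hUsub).mul (hGFhol.mono hUδ)).analyticOnNhd hUopen
  set z₀ : ℂ := ((σm + 1 : ℝ) : ℂ) with hz₀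
  have hz₀re : z₀.re = σm + 1 := by simp [hz₀]
  have hσm1 : 1 ≤ σm := hσ₀.trans ((le_max_left _ _).trans (le_max_left _ _))
  have hz₀U : z₀ ∈ {z : ℂ | 1 < z.re} ∪ Metric.ball (1 : ℂ) δ' := by
    left; simp only [Set.mem_setOf_eq, hz₀re]; linarith
  have hev : (fun z => (z - 1) ^ (k + 1) * H z) =ᶠ[𝓝 z₀] fun z => G z * GF z := by
    have hmem : {z : ℂ | σm < z.re} ∈ 𝓝 z₀ :=
      (isOpen_lt continuous_const Complex.continuous_re).mem_nhds (by
        simp only [Set.mem_setOf_eq, hz₀re]; linarith)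
    exact Filter.eventually_of_mem hmem fun z hz => hfar z hz
  have hEq := h₁.eqOn_of_preconnected_of_eventuallyEq h₂ hUconn hz₀U hev
  have h1U : (1 : ℂ) ∈ {z : ℂ | 1 < z.re} ∪ Metric.ball (1 : ℂ) δ' := Or.inr (Metric.mem_ball_self hδ'pos)
  have h1 := hEq h1U
  simp only [sub_self, zero_pow (Nat.succ_ne_zero k), zero_mul] at h1
  exact mul_ne_zero hG1 hGF1 h1.symm

end Tower

/-! ### The registered transfer (continuation form) -/

/-- **The Asai pole transfer, continuation form** (registered; TRANSFER_CONT of the lead's Cont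
interfaces): in the biquadratic tower `F₀ ⊆ K ⊆ L ⊇ F'` (`[K:F₀] = [L:K] = [L:F'] = 2`, involutions
`cK`, `s` with `s|_K = cK`), for `P` cuspidal on `GL_n(𝔸_L)` (`n ≥ 1`), `s`-conjugate self-dual a.e.,
and `Q` cuspidal on `GL_{2n}(𝔸_K)`, a weak automorphic induction of `P`, `cK`-conjugate self-dual a.e.:
`P.HasAsaiPoleCont s ε → Q.HasAsaiPoleCont cK ε` for every sign `ε`, GRANTED the two published named
facts `Mok2014_partialAsaiL_continuation_pole_dichotomy` (Mok 2014 §2.5, Thm. 2.5.4 (a)) and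
`GrbacShahidi2015_partialAsaiL_at_one` (Grbac–Shahidi 2015 Thm. 4.3 at `s = 1`).  Proof: Mok for `Q`
gives `η_Q` with the continued pole and holomorphy at `-η_Q`; either `ε = η_Q`, or `ε = -η_Q` and the
continuation of `L^{S₁}(Q, As^ε)` clashes with the continued pole of `P` (`exists_clash_datum_cont`).
[cite: Mok2014, Thm. 2.5.4 (a)] [cite: GrbacShahidi2015, Thm. 4.3] [cite: ArthurClozelAMS120, Ch. 3 Def. 6.1] -/
theorem asaiPoleTransfer_cont : Mok2014_partialAsaiL_continuation_pole_dichotomy →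
    GrbacShahidi2015_partialAsaiL_at_one →
    ∀ (F₀ K F' L : Type) [Field F₀] [NumberField F₀] [Field K] [NumberField K] [Field F'] [NumberField F']
      [Field L] [NumberField L] [Algebra F₀ K] [Algebra K L] [Algebra F' L] (cK : K ≃ₐ[F₀] K)
      (s : L ≃ₐ[F'] L), Module.finrank F₀ K = 2 → Module.finrank K L = 2 → Module.finrank F' L = 2 →
      cK ≠ 1 → s ≠ 1 → (∀ x : K, s (algebraMap K L x) = algebraMap K L (cK x)) →
      ∀ (n : ℕ) (hL : isCompact_glFiniteIntegralLevel n L) (hK : isCompact_glFiniteIntegralLevel (2 * n) K)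
        (P : CuspidalAutomorphicRepData n L hL) (Q : CuspidalAutomorphicRepData (2 * n) K hK),
        0 < n → IsAutomorphicInductionAlong P.1 Q.1 → P.1.IsConjSelfDualAE s → Q.1.IsConjSelfDualAE cK →
        ∀ ε : ℤˣ, P.1.HasAsaiPoleCont s ε → Q.1.HasAsaiPoleCont cK ε := by
  intro hMok hGS F₀ K F' L _ _ _ _ _ _ _ _ _ _ _ cK s h2 h2K h2F' hcK hs hsK n hL hK P Q hn hAI hP hQ ε hε
  obtain ⟨ηQ, hηQ, hholQ⟩ := Q.exists_hasAsaiPoleCont hMok h2 hcK (by omega) hQ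
  by_cases h : ε = ηQ
  · rw [h]; exact hηQ
  · exfalso
    obtain ⟨S₁, A, S₁', A', hQd, hPd', clash⟩ :=
      exists_clash_datum_cont hGS h2 h2K h2F' hcK hs hsK P Q hn hAI hP
    refine clash ε (hε hPd') ?_
    obtain ⟨σ₁, -, -, H, hH, hHL, -⟩ := hholQ hQd
    rw [Int.units_ne_iff_eq_neg.mp h]
    exact ⟨σ₁, H, hH, hHL⟩

/-- **The Asai pole transfer as an equivalence, continuation form**: under the same two named facts,
`Q.HasAsaiPoleCont cK ε ↔ P.HasAsaiPoleCont s ε`.  (→): Mok for `P` gives a pole sign `η_P`; if `ε ≠ η_P`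
then `η_P = -ε`, the continued pole of `Q` at `ε` on the matched datum forces `ε = η_Q`
(`hasAsaiPoleCont_unique`), so `L^{S₁}(Q, As^{-ε})` has a holomorphic continuation near `1` while `P`
has its continued pole at `-ε` — clash. [cite: Mok2014, Thm. 2.5.4 (a)] [cite: GrbacShahidi2015, Thm. 4.3] -/
theorem asaiPoleTransfer_cont_iff (hMok : Mok2014_partialAsaiL_continuation_pole_dichotomy)
    (hGS : GrbacShahidi2015_partialAsaiL_at_one)
    {F₀ K F' L : Type} [Field F₀] [NumberField F₀] [Field K] [NumberField K] [Field F'] [NumberField F']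
    [Field L] [NumberField L] [Algebra F₀ K] [Algebra K L] [Algebra F' L] {cK : K ≃ₐ[F₀] K}
    {s : L ≃ₐ[F'] L} (h2 : Module.finrank F₀ K = 2) (h2K : Module.finrank K L = 2)
    (h2F' : Module.finrank F' L = 2) (hcK : cK ≠ 1) (hs : s ≠ 1)
    (hsK : ∀ x : K, s (algebraMap K L x) = algebraMap K L (cK x))
    {n : ℕ} {hL : isCompact_glFiniteIntegralLevel n L} {hK : isCompact_glFiniteIntegralLevel (2 * n) K}
    (P : CuspidalAutomorphicRepData n L hL) (Q : CuspidalAutomorphicRepData (2 * n) K hK) (hn : 0 < n)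
    (hAI : IsAutomorphicInductionAlong P.1 Q.1) (hP : P.1.IsConjSelfDualAE s)
    (hQ : Q.1.IsConjSelfDualAE cK) (ε : ℤˣ) : Q.1.HasAsaiPoleCont cK ε ↔ P.1.HasAsaiPoleCont s ε := by
  refine ⟨fun hε => ?_,
    asaiPoleTransfer_cont hMok hGS F₀ K F' L cK s h2 h2K h2F' hcK hs hsK n hL hK P Q hn hAI hP hQ ε⟩
  have h2n : 0 < 2 * n := by omega
  obtain ⟨ηP, hηP, -⟩ := P.exists_hasAsaiPoleCont hMok h2F' hs hn hP
  obtain ⟨ηQ, hηQ, hholQ⟩ := Q.exists_hasAsaiPoleCont hMok h2 hcK h2n hQ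
  by_cases h : ε = ηP
  · rw [h]; exact hηP
  · exfalso
    obtain ⟨S₁, A, S₁', A', hQd, hPd', clash⟩ :=
      exists_clash_datum_cont hGS h2 h2K h2F' hcK hs hsK P Q hn hAI hP
    have hηP' : ηP = -ε := by rw [Int.units_ne_iff_eq_neg.mp h, neg_neg]
    have hεQ : ε = ηQ := Q.hasAsaiPoleCont_unique hMok h2 hcK h2n hQ hQd hε hηQ
    refine clash ηP (hηP hPd') ?_
    obtain ⟨σ₁, -, -, H, hH, hHL, -⟩ := hholQ hQd
    rw [hηP', hεQ]
    exact ⟨σ₁, H, hH, hHL⟩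

end Summit.Langlands.Langlands.Theorems.HostInducedRep.OneTransparentPane
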